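import Summits.BirchSwinnertonDyer.BirchSwinnertonDyer.Theorems.TameQuarticSolventSolventPairLowerBoundPairGivenGoodFieldOfLower
import Summits.BirchSwinnertonDyer.BirchSwinnertonDyer.Theorems.TameQuarticSolventSolventPairLowerBoundKolyvaginTwistedUpperAnalyticHalfAnyMult
import HarnessLib

/-!
# Route `TameQuarticSolvent`, crux `SolventPairLowerBound` (stmt-BirchSwinnertonDyer-21391), line `birth` —
# the K2a constituents asked ONLY for the twist-datum `d` (square-free, every bad `ℓ ≠ 3` split in `ℚ(√d)`,
# `d ≡ 1 (mod 8)` if `2 ∣ N`): twist datum WITH its splitting data, the pair inequality pointwise in `d`, and the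
# crux BY NAME from PUB⁸′ · K1⁻ · K2a-ES₀″ · K2a-rest₀″

HONEST FRAMING. Theorems only; helper (`--supports stmt-BirchSwinnertonDyer-21391`, width seat `bsd-wall-tqs-p1-w3`
gen 2), CONDITIONAL on the displayed hypotheses; credits nothing toward closing the item; proves neither K1⁻ nor
any Euler-system half. BSD is not proved by any of this; no named fact is introduced.

WHY. The registered v6 stubs K2a-ES₀ / K2a-rest quantify over EVERY `d > 0` with `ord₃ d = 1`, although the
composition (`solventPairLowerBound_of_published_of_K1low_of_K2a`, p582415) only ever uses the `d` delivered by
`friedbergHoffstein_exists_pos_twist_ne_zero_ramifiedAtThree` — square-free, `jacobiSym d ℓ = 1` for every odd bad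
`ℓ ≠ 3`, `d ≡ 1 (mod 8)` if `2 ∣ N_W`, i.e. EVERY bad prime `ℓ ≠ 3` SPLITS in `K = ℚ(√d)`. The memo
`Cruxes/SolventPairLowerBound/PARITY-K2A-REST-w3.md` shows the surplus is not harmless: for 5 of the 19 classes
without multiplicative prime there are admissible `d` (relevant primes inert) for which the twisted constituent
`E′ = E_K ⊗ χ_β` has root number `−1` for EVERY admissible `β` AND no finite discrete-series place (e.g. 189225m with
5, 29 inert) — no Shimura-curve parametrisation over `K`, beyond every Euler system in print; whereas for the
twist-datum `d` every class of the leaf has a discrete-series place (Steinberg or supercuspidal) at which a local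
quadratic character flips the sign. This file supplies the d-RESTRICTED decomposition, kernel-checked:
* `exists_twistModel_of_L_ne_zero` — pointwise form of `stub_twistDatum_of_nonvanishing` (p573628): a given `d > 0`,
  `ord₃ d = 1`, `L(W^{(d)},1) ≠ 0` yields the globally minimal, non-CM, (t′), analytic-rank-zero model `Wd`;
* `exists_twistDatum_split_of_friedbergHoffstein` — `stub_twistDatum` RE-EXPORTED WITH the three splitting conjuncts
  of FH₃'s conclusion (they were discarded in p579407);
* `pair_le_of_K1low_of_K2aAt` — the pair inequality of `stub_pairGivenGoodField_of_lower` (p582415) with K2a asked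
  only AT the given `(W, d)` (proof adapted verbatim from p582415);
* `solventPairLowerBound_of_published_of_K1low_of_K2aES0split_of_K2aRest0split` — the crux BY NAME from PUB⁸′ (PUB⁸
  with the any-`ℓ₀` Friedberg–Hoffstein instance), K1⁻ (unchanged), and the d-RESTRICTED Euler-system statements
  K2a-ES₀″ (any multiplicative `ℓ₀ ≠ 3`; `∀ β` with `L ≠ 0`) and K2a-rest₀″ (no multiplicative prime; `∃ β`), both
  carrying `Squarefree d`, the `jacobiSym` conditions and `d % 8 = 1`. Suggested v7 texts = the hypotheses `K2aES0`,
  `K2aRest0` of that theorem verbatim. CONDITIONAL; credits nothing.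

References: S. Friedberg, J. Hoffstein, Ann. of Math. 142 (1995) Thm. B (1); T. Dokchitser, V. Dokchitser, Ann. of
Math. 172 (2010) Thm. 2.3; J. S. Milne, Invent. Math. 17 (1972) Thm. 1; B. Gross, D. Zagier, Invent. Math. 84 (1986)
Thm. I.(7.3); J. H. Silverman, *AEC* VIII.8.3.
-/

-- D-0017: single-problem summit, so `Summit.BirchSwinnertonDyer.BirchSwinnertonDyer.…` repeats a namespace BY DESIGN.
set_option linter.dupNamespace false

noncomputable section

open scoped Classical NumberField

open IsDedekindDomain IsDedekindDomain.HeightOneSpectrum NumberField WithZero WeierstrassCurve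
  Literature.NumberTheory.EllipticCurves Literature.NumberTheory.EllipticCurves.ModularForms
  Literature.NumberTheory.EllipticCurves.Rank1Residual Summit.BirchSwinnertonDyer.Rank1Residual.Additive

namespace Summit.BirchSwinnertonDyer.BirchSwinnertonDyer.Theorems.SolventPairLowerBound

/-! ## The twist datum with its splitting data -/

/-- **A given admissible non-vanishing twist has a leaf-shaped rank-zero model** (pointwise form of
`stub_twistDatum_of_nonvanishing`, p573628): for `W` on the leaf and `d > 0` with `ord₃ d = 1` and `L(W^{(d)}, 1) ≠ 0`
there is a globally minimal model `Wd` of `W^{(d)}`, non-CM, additive of class (t′) at `3`, with `r_an(Wd) = 0`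
(global minimal model: Silverman *AEC* VIII.8.3; non-CM and (t′) are twist-stable; `r_an = 0 ⟺ L(1) ≠ 0` given
modularity). [cite: SilvermanAEC2009, VIII.8 Cor. 8.3 and X.5 Cor. 5.4] [cite: BCDTJAMS2001, Thm. A] -/
theorem exists_twistModel_of_L_ne_zero (hmod : exists_isNewformOf)
    (W : WeierstrassCurve ℚ) [W.IsElliptic] [W.IsGloballyMinimal] (hCM : ¬ W.HasCM) (hadd : Addv W 3)
    (hsub : Summit.BirchSwinnertonDyer.Rank1Residual.Additive.SubTprime W 3)
    (d : ℤ) (hd0 : 0 < d) (hd3 : padicValInt 3 d = 1) (hL : (W.quadraticTwist (d : ℚ)).entireLFunction 1 ≠ 0) :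
    ∃ (Wd : WeierstrassCurve ℚ) (_ : Wd.IsElliptic) (_ : Wd.IsGloballyMinimal),
      (∃ C : WeierstrassCurve.VariableChange ℚ, C • W.quadraticTwist (d : ℚ) = Wd) ∧
      ¬ Wd.HasCM ∧ Addv Wd 3 ∧ Summit.BirchSwinnertonDyer.Rank1Residual.Additive.SubTprime Wd 3 ∧
      Wd.analyticRank = 0 := by
  have hdq : (d : ℚ) ≠ 0 := by exact_mod_cast hd0.ne'
  haveI := W.isElliptic_quadraticTwist hdq
  obtain ⟨C, hC⟩ := hasGlobalMinimalModel_rat_holds (W.quadraticTwist (d : ℚ))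
  haveI : (C • W.quadraticTwist (d : ℚ)).IsGloballyMinimal := hC
  have htw : ∃ C' : WeierstrassCurve.VariableChange ℚ,
      C' • W.quadraticTwist (d : ℚ) = C • W.quadraticTwist (d : ℚ) := ⟨C, rfl⟩
  obtain ⟨haddd, hsubd⟩ :=
    addv_and_subTprime_of_twist_three W hadd hsub hd3 (C • W.quadraticTwist (d : ℚ)) htw
  refine ⟨C • W.quadraticTwist (d : ℚ), inferInstance, hC, htw, ?_, haddd, hsubd, ?_⟩
  · exact fun h ↦ hCM ((hasCM_iff_of_model_twist hdq htw).mp h)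
  · rw [analyticRank_smul]
    exact ((W.quadraticTwist (d : ℚ)).analyticRank_eq_zero_iff_holds
      (hasEntireLFunction_rat_of_exists_isNewformOf hmod _)).mpr hL

/-- **`stub_twistDatum` WITH the splitting data of the twist** (the three conjuncts of the conclusion of
`friedbergHoffstein_exists_pos_twist_ne_zero_ramifiedAtThree` that p579407 discarded): GIVEN modularity and FH₃, every
`W` on the leaf has `d > 0`, `ord₃ d = 1`, SQUARE-FREE, with `jacobiSym d ℓ = 1` for every odd prime `ℓ ∣ N_W` other
than `3` and `d ≡ 1 (mod 8)` if `2 ∣ N_W` — so every bad prime `ℓ ≠ 3` SPLITS in `ℚ(√d)` — and a globally minimal,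
non-CM, (t′), analytic-rank-zero model `Wd` of `W^{(d)}`.
[cite: FriedbergHoffstein1995, Thm. B (1)] [cite: Kobayashi2002, Thm. 1.1 (ii)] [cite: BCDTJAMS2001, Thm. A] -/
theorem exists_twistDatum_split_of_friedbergHoffstein (hmod : exists_isNewformOf)
    (hFH : friedbergHoffstein_exists_pos_twist_ne_zero_ramifiedAtThree) :
    ∀ (W : WeierstrassCurve ℚ) [W.IsElliptic] [W.IsGloballyMinimal],
      ¬ W.HasCM → Addv W 3 → Summit.BirchSwinnertonDyer.Rank1Residual.Additive.SubTprime W 3 →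
      W.analyticRank = 1 →
      ∃ (d : ℤ) (Wd : WeierstrassCurve ℚ) (_ : Wd.IsElliptic) (_ : Wd.IsGloballyMinimal),
        0 < d ∧ padicValInt 3 d = 1 ∧ Squarefree d ∧
        (∀ ℓ : ℕ, ℓ.Prime → (ℓ : ℤ) ∣ W.conductorNorm ℤ → ℓ ≠ 2 → ℓ ≠ 3 → jacobiSym d ℓ = 1) ∧
        ((2 : ℤ) ∣ W.conductorNorm ℤ → d % 8 = 1) ∧
        (∃ C : WeierstrassCurve.VariableChange ℚ, C • W.quadraticTwist (d : ℚ) = Wd) ∧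
        ¬ Wd.HasCM ∧ Addv Wd 3 ∧ Summit.BirchSwinnertonDyer.Rank1Residual.Additive.SubTprime Wd 3 ∧
        Wd.analyticRank = 0 := by
  intro W _ _ hCM hadd hsub hr
  have hw : W.rootNumber = -1 :=
    Summit.BirchSwinnertonDyer.Rank1Residual.O5.HeegnerLogTransport.rootNumber_eq_neg_one_of_analyticRank_eq_one
      hmod W hr
  have hj : 0 ≤ padicValRat 3 W.j := not_lt.mp hsub.1
  have hIII : W.kodairaSymbolAt (Summit.BirchSwinnertonDyer.Rank1Residual.Additive.placeOf 3) = .III ∨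
      W.kodairaSymbolAt (Summit.BirchSwinnertonDyer.Rank1Residual.Additive.placeOf 3) = .IIIstar :=
    (Summit.BirchSwinnertonDyer.Rank1Residual.Additive.subTprime_three_iff_kodairaSymbolAt_III_or_IIIstar
      W hadd).mp hsub
  obtain ⟨d, hBd, hsq, hv, hjac, h8, hL⟩ := hFH W hw hj hIII 0
  have hd0 : 0 < d := by exact_mod_cast hBd
  obtain ⟨Wd, i1, i2, htw, hCMd, haddd, hsubd, hr0⟩ := exists_twistModel_of_L_ne_zero hmod W hCM hadd hsub d hd0 hv hL
  exact ⟨d, Wd, i1, i2, hd0, hv, hsq, hjac, h8, htw, hCMd, haddd, hsubd, hr0⟩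

/-! ## The pair inequality with K2a asked only at `(W, d)` -/

/-- **The pair inequality from K1⁻ and K2a AT the given `(W, d)`** — `stub_pairGivenGoodField_of_lower` (p582415)
with its universally quantified K2a hypothesis replaced by its instance at the curve `W` and the integer `d` in hand
(still for every quadratic `K ∋ θ₁`, `θ₁² = d`, since `K` is constructed inside the proof). GIVEN
Dokchitser–Dokchitser/Milne (`hDD`), modularity (`hmod`, `hmodP`), Gross–Zagier I.(7.3) (`hGZ`), Gross–Zagier–Kolyvagin
(`hGZK`), K1⁻ and that instance: `ord₃ #Ш_an(W) + ord₃ #Ш_an(Wd) ≤ ord₃ #Ш(W) + ord₃ #Ш(Wd)`. Proof adapted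
verbatim from p582415 (valuation identity `padicValRat_analyticSha_quadraticTower` over `ℚ ⊂ K ⊂ M = K(√β)`,
`linarith`). CONDITIONAL; credits nothing.
[cite: DokchitserDokchitserAnnals2010, §2.1 Thm. 2.3 (second clause) and its proof]
[cite: Miller2011LMS, §1 and Def. 1.1 (arXiv:1010.2431 p. 3)] -/
theorem pair_le_of_K1low_of_K2aAt
    (hDD : Milne1972.bsdQuotientP_baseChange_relQuadratic_anyModel)
    (hmod : exists_isNewformOf) (hmodP : nonempty_modularParametrizationData)
    (hGZ : GrossZagier1986_thm_I_7_3) (hGZK : rank_eq_analyticRank_of_analyticRank_le_one)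
    (K1low : ∀ (W : WeierstrassCurve ℚ) [W.IsElliptic] [W.IsGloballyMinimal],
      ¬ W.HasCM → Addv W 3 → Summit.BirchSwinnertonDyer.Rank1Residual.Additive.SubTprime W 3 →
      W.analyticRank = 1 →
      ∀ (K : Type) [Field K] [NumberField K] (M : Type) [Field M] [NumberField M] [Algebra K M],
        Module.finrank ℚ K = 2 → Module.finrank K M = 2 → IsTotallyReal M →
        (∀ w : HeightOneSpectrum (𝓞 M), ((3 : ℕ) : 𝓞 M) ∈ w.asIdeal →
          w.asIdeal.ramificationIdx ℤ = 4) →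
        (∀ w : HeightOneSpectrum (𝓞 M), ((3 : ℕ) : 𝓞 M) ∈ w.asIdeal →
          (W.baseChange M).HasGoodReductionAt w) →
        Finite (AddCommGroup.primaryComponent (W.baseChange M).sha 3) →
        ∀ qM : ℚ, analyticSha (W.baseChange M) = (qM : ℂ) →
          padicValRat 3 qM ≤
            padicValNat 3 (Nat.card (AddCommGroup.primaryComponent (W.baseChange M).sha 3)))
    (W : WeierstrassCurve ℚ) [W.IsElliptic] [W.IsGloballyMinimal] (hCM : ¬ W.HasCM) (hadd : Addv W 3)
    (hsub : Summit.BirchSwinnertonDyer.Rank1Residual.Additive.SubTprime W 3) (hr : W.analyticRank = 1)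
    (d : ℤ) (hd0 : 0 < d) (hd : padicValInt 3 d = 1)
    (K2aAt : ∀ (K : Type) [Field K] [NumberField K] (θ₁ : K), Module.finrank ℚ K = 2 → θ₁ ^ 2 = (d : K) →
        ∃ β : K,
          (∀ v : HeightOneSpectrum (𝓞 K), ((3 : ℕ) : 𝓞 K) ∈ v.asIdeal →
            ∃ k : ℤ, v.valuation K β = WithZero.exp (2 * k + 1)) ∧
          (∀ σ : K →+* ℝ, 0 < σ β) ∧
          ∃ (Vβ : WeierstrassCurve K) (_ : Vβ.IsElliptic),
            (∃ C : WeierstrassCurve.VariableChange K, C • (W.baseChange K).quadraticTwist β = Vβ) ∧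
            Vβ.HasEntireLFunction ∧
            Finite (AddCommGroup.primaryComponent Vβ.sha 3) ∧
            ∃ qβ : ℚ, analyticSha Vβ = (qβ : ℂ) ∧
              (padicValNat 3 (Nat.card (AddCommGroup.primaryComponent Vβ.sha 3)) : ℤ) ≤
                padicValRat 3 qβ)
    (Wd : WeierstrassCurve ℚ) [Wd.IsElliptic] [Wd.IsGloballyMinimal]
    (hWd : ∃ C : WeierstrassCurve.VariableChange ℚ, C • W.quadraticTwist (d : ℚ) = Wd) (hr0 : Wd.analyticRank = 0) :
    ∃ q q' : ℚ, shaAn W = (q : ℂ) ∧ shaAn Wd = (q' : ℂ) ∧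
      padicValRat 3 q + padicValRat 3 q' ≤
        (padicValNat 3 W.shaOrder : ℤ) + (padicValNat 3 Wd.shaOrder : ℤ) := by
  -- adapted from p582415 `stub_pairGivenGoodField_of_lower` (w3 g0)
  have hgood := stub_goodReduction W hadd hsub
  have hE : hasEntireLFunction_rat := WeierstrassCurve.hasEntireLFunction_rat_of_exists_isNewformOf hmod
  have hAM : ArtinMilneShaDecomposition := artinMilneShaDecomposition_of_relQuadratic hDD
  obtain ⟨qW, hqW⟩ := Disegni2020.exists_rat_shaAn_eq_of_analyticRank_eq_one hGZ hGZK W hr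
  obtain ⟨qWd, hqWd⟩ := exists_rat_shaAn_eq_of_analyticRank_eq_zero hmodP hGZK Wd hr0
  haveI : Finite W.sha := (hGZK W (by omega)).2
  haveI : Finite Wd.sha := (hGZK Wd (by omega)).2
  -- the real quadratic field `K = ℚ(√d)`
  obtain ⟨K, _, _, θ₁, h2, hθ₁, hθK⟩ :=
    exists_quadraticField_sq_eq_intCast (not_isSquare_ratCast_of_padicValInt_eq_one 3 hd)
  have hWd' := exists_variableChange_quadraticTwist_discr h2 hθ₁ hθK W Wd hWd
  -- K2a at `(W, d)`: the element `β` and the twisted model over `K`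
  obtain ⟨β, hval, hpos, Vβ, _, hVβ, hVβL, hβfin, qβ, hqβ, hβup⟩ := K2aAt K θ₁ h2 hθ₁
  obtain ⟨v₀, hv₀⟩ := exists_heightOneSpectrum_natCast_mem K 3
  obtain ⟨k₀, hk₀⟩ := hval v₀ hv₀
  obtain ⟨M, _, _, _, θ, h2', hθ, hθM⟩ := exists_relQuadratic_sq_eq (not_isSquare_of_valuation_eq_exp v₀ hk₀)
  -- properties of `M`
  have he : ∀ w : HeightOneSpectrum (𝓞 M), ((3 : ℕ) : 𝓞 M) ∈ w.asIdeal →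
      w.asIdeal.ramificationIdx ℤ = 4 := fun w hw ↦ by
    have h := ramificationIdx_int_eq_of_sq_eq (K := K) (M := M) 3 h2' hθ (e₀ := 2)
      (fun v hv ↦ ⟨(ramificationIdx_eq_two_of_sq_eq_intCast 3 h2 hθ₁ hd v hv).1, hval v hv⟩) w hw
    simpa using h
  have hgoodM : ∀ w : HeightOneSpectrum (𝓞 M), ((3 : ℕ) : 𝓞 M) ∈ w.asIdeal →
      (W.baseChange M).HasGoodReductionAt w := fun w hw ↦ hgood M w hw (he w hw)
  have hTR : IsTotallyReal M :=
    isTotallyReal_of_sq_eq_of_totallyPositive h2 hd0.le hθ₁ hθK h2' hθ hθM hpos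
  -- the valuation identity over `ℚ ⊂ K ⊂ M`
  haveI : (W.baseChange M).IsElliptic := by
    rw [WeierstrassCurve.baseChange]; infer_instance
  have hVM : ∃ C : WeierstrassCurve.VariableChange M, C • W.baseChange M = W.baseChange M :=
    ⟨1, one_smul _ _⟩
  obtain ⟨hfVM, qM, hqM, -, -, -, -, hδ⟩ :=
    padicValRat_analyticSha_quadraticTower hAM W K h2 Wd hWd' M h2' hθ hθM Vβ hVβ (W.baseChange M) hVM 3
      inferInstance inferInstance hβfin (hE W) (hE Wd) hVβL hqW hqWd hqβ
  -- K1⁻: the lower bound over `M`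
  have hlow := K1low W hCM hadd hsub hr K M h2 h2' hTR he hgoodM hfVM qM hqM
  refine ⟨qW, qWd, hqW, hqWd, ?_⟩
  have h : padicValRat 3 qW + padicValRat 3 qWd ≤
      (padicValNat 3 (Nat.card (AddCommGroup.primaryComponent W.sha 3)) : ℤ) +
        (padicValNat 3 (Nat.card (AddCommGroup.primaryComponent Wd.sha 3)) : ℤ) := by
    linarith
  rwa [padicValNat_card_addPrimaryComponent (A := W.sha) 3,
    padicValNat_card_addPrimaryComponent (A := Wd.sha) 3] at h

/-! ## The crux by name from PUB⁸′, K1⁻ and the d-restricted K2a constituents (CONDITIONAL) -/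

/-- **Crux `SolventPairLowerBound` BY NAME from PUB⁸′, K1⁻, K2a-ES₀″ and K2a-rest₀″** — the d-RESTRICTED
decomposition: the Euler-system statements are asked only for square-free `d > 0`, `ord₃ d = 1`, with
`jacobiSym d ℓ = 1` at every odd bad `ℓ ≠ 3` and `d ≡ 1 (mod 8)` if `2 ∣ N_W` (every bad prime `ℓ ≠ 3` split in
`K`), exactly the class of `exists_twistDatum_split_of_friedbergHoffstein`. K2a-ES₀″: `W` with a multiplicative
`ℓ₀ ≠ 3`, every such `d`, every `K ∋ θ₁`, every admissible `β` with `L((W_K)^{(β)}, 1) ≠ 0` ⟹ `Ш[3^∞]` finite,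
`#Ш_an ∈ ℚ`, `ord₃ #Ш[3^∞] ≤ ord₃ #Ш_an`. K2a-rest₀″: `W` with NO multiplicative `ℓ₀ ≠ 3` (19 census classes),
every such `d`, `K`, `θ₁` ⟹ some admissible `β` and model with the same three properties. Composition: twist datum
with splitting data → analytic half at any multiplicative prime (w2 gen 2) + K2a-ES₀″, or K2a-rest₀″ → the pair
inequality `pair_le_of_K1low_of_K2aAt`. CONDITIONAL on all hypotheses; credits nothing toward closing the item; the
one-line closer of a route-level split with these texts.
[cite: DokchitserDokchitserAnnals2010, §2.1 Thm. 2.3] [cite: FriedbergHoffstein1995, Thm. B (1)]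
[cite: GrossZagier1986, Thm. I.(7.3)] [cite: Milne1972ArithmeticAV, §1 Thm. 1] -/
theorem solventPairLowerBound_of_published_of_K1low_of_K2aES0split_of_K2aRest0split
    (hPUB :
      exists_isNewformOf ∧ nonempty_modularParametrizationData ∧ GrossZagier1986_thm_I_7_3 ∧
        rank_eq_analyticRank_of_analyticRank_le_one ∧
        Milne1972.bsdQuotientP_baseChange_relQuadratic_anyModel ∧
        friedbergHoffstein_exists_pos_twist_ne_zero_ramifiedAtThree ∧
        friedbergHoffstein_exists_twist_ne_zero_realQuadratic_tameAtThree_anyMult ∧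
        friedbergHoffstein_exists_twist_ne_zero_realQuadratic_tameAtThree_noflip)
    (K1low : ∀ (W : WeierstrassCurve ℚ) [W.IsElliptic] [W.IsGloballyMinimal],
      ¬ W.HasCM → Addv W 3 → Summit.BirchSwinnertonDyer.Rank1Residual.Additive.SubTprime W 3 →
      W.analyticRank = 1 →
      ∀ (K : Type) [Field K] [NumberField K] (M : Type) [Field M] [NumberField M] [Algebra K M],
        Module.finrank ℚ K = 2 → Module.finrank K M = 2 → IsTotallyReal M →
        (∀ w : HeightOneSpectrum (𝓞 M), ((3 : ℕ) : 𝓞 M) ∈ w.asIdeal →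
          w.asIdeal.ramificationIdx ℤ = 4) →
        (∀ w : HeightOneSpectrum (𝓞 M), ((3 : ℕ) : 𝓞 M) ∈ w.asIdeal →
          (W.baseChange M).HasGoodReductionAt w) →
        Finite (AddCommGroup.primaryComponent (W.baseChange M).sha 3) →
        ∀ qM : ℚ, analyticSha (W.baseChange M) = (qM : ℂ) →
          padicValRat 3 qM ≤
            padicValNat 3 (Nat.card (AddCommGroup.primaryComponent (W.baseChange M).sha 3)))
    (K2aES0 : ∀ (W : WeierstrassCurve ℚ) [W.IsElliptic] [W.IsGloballyMinimal],
      ¬ W.HasCM → Addv W 3 → Summit.BirchSwinnertonDyer.Rank1Residual.Additive.SubTprime W 3 →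
      W.analyticRank = 1 →
      (∃ (ℓ₀ : ℕ) (_ : Fact ℓ₀.Prime), ℓ₀ ≠ 3 ∧ W.HasMultiplicativeReductionAtPrime ℓ₀) →
      ∀ (d : ℤ), 0 < d → padicValInt 3 d = 1 → Squarefree d →
      (∀ ℓ : ℕ, ℓ.Prime → (ℓ : ℤ) ∣ W.conductorNorm ℤ → ℓ ≠ 2 → ℓ ≠ 3 → jacobiSym d ℓ = 1) →
      ((2 : ℤ) ∣ W.conductorNorm ℤ → d % 8 = 1) →
      ∀ (K : Type) [Field K] [NumberField K] (θ₁ : K), Module.finrank ℚ K = 2 → θ₁ ^ 2 = (d : K) →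
      ∀ β : K,
        (∀ v : HeightOneSpectrum (𝓞 K), ((3 : ℕ) : 𝓞 K) ∈ v.asIdeal →
          ∃ k : ℤ, v.valuation K β = WithZero.exp (2 * k + 1)) →
        (∀ σ : K →+* ℝ, 0 < σ β) →
        ((W.baseChange K).quadraticTwist β).HasEntireLFunction →
        ((W.baseChange K).quadraticTwist β).entireLFunction 1 ≠ 0 →
        Finite (AddCommGroup.primaryComponent ((W.baseChange K).quadraticTwist β).sha 3) ∧
          ∃ qβ : ℚ, analyticSha ((W.baseChange K).quadraticTwist β) = (qβ : ℂ) ∧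
            (padicValNat 3
                (Nat.card (AddCommGroup.primaryComponent ((W.baseChange K).quadraticTwist β).sha 3)) : ℤ) ≤
              padicValRat 3 qβ)
    (K2aRest0 : ∀ (W : WeierstrassCurve ℚ) [W.IsElliptic] [W.IsGloballyMinimal],
      ¬ W.HasCM → Addv W 3 → Summit.BirchSwinnertonDyer.Rank1Residual.Additive.SubTprime W 3 →
      W.analyticRank = 1 →
      ¬ (∃ (ℓ₀ : ℕ) (_ : Fact ℓ₀.Prime), ℓ₀ ≠ 3 ∧ W.HasMultiplicativeReductionAtPrime ℓ₀) →
      ∀ (d : ℤ), 0 < d → padicValInt 3 d = 1 → Squarefree d →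
      (∀ ℓ : ℕ, ℓ.Prime → (ℓ : ℤ) ∣ W.conductorNorm ℤ → ℓ ≠ 2 → ℓ ≠ 3 → jacobiSym d ℓ = 1) →
      ((2 : ℤ) ∣ W.conductorNorm ℤ → d % 8 = 1) →
      ∀ (K : Type) [Field K] [NumberField K] (θ₁ : K), Module.finrank ℚ K = 2 → θ₁ ^ 2 = (d : K) →
        ∃ β : K,
          (∀ v : HeightOneSpectrum (𝓞 K), ((3 : ℕ) : 𝓞 K) ∈ v.asIdeal →
            ∃ k : ℤ, v.valuation K β = WithZero.exp (2 * k + 1)) ∧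
          (∀ σ : K →+* ℝ, 0 < σ β) ∧
          ∃ (Vβ : WeierstrassCurve K) (_ : Vβ.IsElliptic),
            (∃ C : WeierstrassCurve.VariableChange K, C • (W.baseChange K).quadraticTwist β = Vβ) ∧
            Vβ.HasEntireLFunction ∧
            Finite (AddCommGroup.primaryComponent Vβ.sha 3) ∧
            ∃ qβ : ℚ, analyticSha Vβ = (qβ : ℂ) ∧
              (padicValNat 3 (Nat.card (AddCommGroup.primaryComponent Vβ.sha 3)) : ℤ) ≤
                padicValRat 3 qβ) :
    Summit.BirchSwinnertonDyer.BirchSwinnertonDyer.Theses.TameQuarticSolvent.SolventPairLowerBound := by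
  obtain ⟨hmod, hmodP, hGZ, hGZK, hDD, hFH3, hFH, hFH'⟩ := hPUB
  intro W _ _ hCM hadd hsub hr
  obtain ⟨d, Wd, i1, i2, hd0, hd, hsq, hjac, h8, htw, hCMd, haddd, hsubd, hr0⟩ :=
    exists_twistDatum_split_of_friedbergHoffstein hmod hFH3 W hCM hadd hsub hr
  refine ⟨d, Wd, i1, i2, hd0, hd, htw, hCMd, haddd, hsubd, hr0,
    pair_le_of_K1low_of_K2aAt hDD hmod hmodP hGZ hGZK K1low W hCM hadd hsub hr d hd0 hd ?_ Wd htw hr0⟩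
  -- K2a at `(W, d)` from the analytic half (any multiplicative prime) + K2a-ES₀″, or from K2a-rest₀″
  intro K _ _ θ₁ h2 hθ₁
  by_cases hmult : ∃ (ℓ₀ : ℕ) (_ : Fact ℓ₀.Prime), ℓ₀ ≠ 3 ∧ W.HasMultiplicativeReductionAtPrime ℓ₀
  · obtain ⟨β, hval, hpos, hL, hL1⟩ :=
      exists_totallyPositive_oddAtThree_twist_L_ne_zero_of_friedbergHoffstein_anyMult hmod hFH hFH'
        W hCM hadd hsub hr hmult d hd0 hd K θ₁ h2 hθ₁
    obtain ⟨hfin, qβ, hqβ, hle⟩ :=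
      K2aES0 W hCM hadd hsub hr hmult d hd0 hd hsq hjac h8 K θ₁ h2 hθ₁ β hval hpos hL hL1
    have hβ0 : β ≠ 0 := by
      intro h0
      obtain ⟨v, hv⟩ := exists_heightOneSpectrum_natCast_mem K 3
      obtain ⟨k, hk⟩ := hval v hv
      rw [h0, map_zero] at hk
      exact WithZero.exp_ne_zero hk.symm
    haveI : (W.baseChange K).IsElliptic := by rw [WeierstrassCurve.baseChange]; infer_instance
    haveI : NeZero (2 : K) := ⟨two_ne_zero⟩
    exact ⟨β, hval, hpos, (W.baseChange K).quadraticTwist β, isElliptic_quadraticTwist _ hβ0,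
      ⟨1, one_smul _ _⟩, hL, hfin, qβ, hqβ, hle⟩
  · exact K2aRest0 W hCM hadd hsub hr hmult d hd0 hd hsq hjac h8 K θ₁ h2 hθ₁

end Summit.BirchSwinnertonDyer.BirchSwinnertonDyer.Theorems.SolventPairLowerBound

end
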